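import Summits.ABC.ABC.Theses.FeketeScales

/-!
# `SparseGoodScales` (stmt-ABC-2161): the five `{2, q}`-unit equations behind the small scales

Negative support lemmas for the crux `Summit.ABC.ABC.Theses.FeketeScales.SparseGoodScales`
(lead seat c5).  An abc triple with `rad(abc) ≤ 29` has prime support `{2}` or `{2, q}` with
`q ∈ {3, 5, 7, 11, 13}`, and is then `(1, 2^i, q^j)` or `(1, q^j, 2^i)` up to order; so the complete
list of such triples is governed by the exponential equations `2^i + 1 = q^j` and `q^j + 1 = 2^i`.
This file solves them (all classical and elementary — Levi ben Gerson 1343 for `q = 3`; congruences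
mod `3, 4, 5, 8, 16` and the factorisation `q^(2m) − 1 = (q^m − 1)(q^m + 1)` otherwise):

* `2^i + 1 = 3^j ↔ (i, j) ∈ {(1, 1), (3, 2)}`,  `3^j + 1 = 2^i ↔ (j, i) ∈ {(0, 1), (1, 2)}`;
* `2^i + 1 = 5^j ↔ (i, j) = (2, 1)`,            `5^j + 1 = 2^i ↔ (j, i) = (0, 1)`;
* `2^i + 1 ≠ 7^j`,                               `7^j + 1 = 2^i ↔ (j, i) ∈ {(0, 1), (1, 3)}`;
* `2^i + 1 ≠ 11^j`,                              `11^j + 1 = 2^i ↔ (j, i) = (0, 1)`;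
* `2^i + 1 ≠ 13^j`,                              `13^j + 1 = 2^i ↔ (j, i) = (0, 1)`.

Summary used downstream (`Negative/ExactZero.lean`): for an odd prime `q ≤ 13`, `2^i + 1 = q^j`
forces `q^j ≤ 9` and `q^j + 1 = 2^i` forces `2^i ≤ 8`; hence `G(R) = 9` for `9 ≤ R ≤ 29`, and with
`Negative/CoverChain.lean` the exponent-`1` bad scales are EXACTLY `{6, 7, 8} ∪ [30, ∞)`.
-/

namespace Summit.ABC.ABC.Theorems.SparseGoodScales.Negative

/-! ## Residues of powers -/

/-- `3^j mod 8 ∈ {1, 3}`. [folklore] -/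
theorem three_pow_mod_eight (j : ℕ) : 3 ^ j % 8 = 1 ∨ 3 ^ j % 8 = 3 := by
  induction j with
  | zero => left; norm_num
  | succ k ih =>
    rw [pow_succ, Nat.mul_mod]
    rcases ih with h | h <;> rw [h] <;> norm_num

/-- `3^(2m+1) ≡ 3 (mod 8)`. [folklore] -/
theorem three_pow_odd_mod_eight (m : ℕ) : 3 ^ (2 * m + 1) % 8 = 3 := by
  rw [pow_succ, pow_mul, Nat.mul_mod, Nat.pow_mod]; norm_num

/-- `3^j ≡ 1 (mod 8)` forces `j` even. [folklore] -/
theorem even_of_three_pow_mod_eight {j : ℕ} (h : 3 ^ j % 8 = 1) : Even j := by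
  rcases Nat.even_or_odd j with hj | hj
  · exact hj
  · exfalso
    obtain ⟨m, rfl⟩ := hj
    have h13 : (1 : ℕ) = 3 := h.symm.trans (three_pow_odd_mod_eight m)
    norm_num at h13

/-- `5^(2m+1) ≡ 5 (mod 8)`. [folklore] -/
theorem five_pow_odd_mod_eight (m : ℕ) : 5 ^ (2 * m + 1) % 8 = 5 := by
  rw [pow_succ, pow_mul, Nat.mul_mod, Nat.pow_mod]; norm_num

/-- `5^j ≡ 1 (mod 8)` forces `j` even. [folklore] -/
theorem even_of_five_pow_mod_eight {j : ℕ} (h : 5 ^ j % 8 = 1) : Even j := by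
  rcases Nat.even_or_odd j with hj | hj
  · exact hj
  · exfalso
    obtain ⟨m, rfl⟩ := hj
    have h15 : (1 : ℕ) = 5 := h.symm.trans (five_pow_odd_mod_eight m)
    norm_num at h15

/-- `7^j mod 16 ∈ {1, 7}`. [folklore] -/
theorem seven_pow_mod_sixteen (j : ℕ) : 7 ^ j % 16 = 1 ∨ 7 ^ j % 16 = 7 := by
  induction j with
  | zero => left; norm_num
  | succ k ih =>
    rw [pow_succ, Nat.mul_mod]
    rcases ih with h | h <;> rw [h] <;> norm_num

/-- `11^j mod 8 ∈ {1, 3}`. [folklore] -/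
theorem eleven_pow_mod_eight (j : ℕ) : 11 ^ j % 8 = 1 ∨ 11 ^ j % 8 = 3 := by
  induction j with
  | zero => left; norm_num
  | succ k ih =>
    rw [pow_succ, Nat.mul_mod]
    rcases ih with h | h <;> rw [h] <;> norm_num

/-- `2^i mod 3 ∈ {1, 2}`. [folklore] -/
theorem two_pow_mod_three (i : ℕ) : 2 ^ i % 3 = 1 ∨ 2 ^ i % 3 = 2 := by
  induction i with
  | zero => left; norm_num
  | succ k ih =>
    rw [pow_succ, Nat.mul_mod]
    rcases ih with h | h <;> rw [h] <;> norm_num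

/-- `5 ∤ 2^i`. [folklore] -/
theorem two_pow_mod_five_ne_zero (i : ℕ) : 2 ^ i % 5 ≠ 0 := by
  intro h
  have h5 : 5 ∣ 2 ^ i := Nat.dvd_of_mod_eq_zero h
  have := Nat.Prime.dvd_of_dvd_pow (by norm_num : Nat.Prime 5) h5
  norm_num at this

/-- `4 ∣ 2^i` for `i ≥ 2`. [folklore] -/
theorem four_dvd_two_pow {i : ℕ} (hi : 2 ≤ i) : 4 ∣ 2 ^ i := by
  have : 2 ^ 2 ∣ 2 ^ i := pow_dvd_pow 2 hi
  simpa using this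

/-- `8 ∣ 2^i` for `i ≥ 3`. [folklore] -/
theorem eight_dvd_two_pow {i : ℕ} (hi : 3 ≤ i) : 8 ∣ 2 ^ i := by
  have : 2 ^ 3 ∣ 2 ^ i := pow_dvd_pow 2 hi
  simpa using this

/-- `16 ∣ 2^i` for `i ≥ 4`. [folklore] -/
theorem sixteen_dvd_two_pow {i : ℕ} (hi : 4 ≤ i) : 16 ∣ 2 ^ i := by
  have : 2 ^ 4 ∣ 2 ^ i := pow_dvd_pow 2 hi
  simpa using this

/-- A power of two is not `3`. [folklore] -/
theorem two_pow_ne_three (i : ℕ) : 2 ^ i ≠ 3 := by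
  intro h
  rcases Nat.lt_or_ge i 2 with hi | hi
  · interval_cases i <;> simp at h
  · have := four_dvd_two_pow hi
    rw [h] at this
    norm_num at this

/-- `q ^ j = q ^ k` with `q ≥ 2` gives `j = k` (exponent injectivity, explicit base). [folklore] -/
theorem pow_exp_eq {q j k : ℕ} (hq : 2 ≤ q) (h : q ^ j = q ^ k) : j = k :=
  Nat.pow_right_injective hq h

/-! ## The factorisation step `(u − 1)(u + 1) = 2^i ⟹ u = 3` -/

/-- If `(u − 1)(u + 1)` is a power of two and `u ≥ 2` then `u = 3`. [folklore] -/
theorem eq_three_of_pred_mul_succ_eq_two_pow {u i : ℕ} (hu : 2 ≤ u) (h : (u - 1) * (u + 1) = 2 ^ i) :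
    u = 3 := by
  have h1 : u - 1 ∣ 2 ^ i := Dvd.intro _ h
  have h2 : u + 1 ∣ 2 ^ i := Dvd.intro_left _ h
  obtain ⟨k, -, hk⟩ := (Nat.dvd_prime_pow Nat.prime_two).mp h1
  obtain ⟨l, -, hl⟩ := (Nat.dvd_prime_pow Nat.prime_two).mp h2
  have hkpos : 1 ≤ 2 ^ k := Nat.one_le_two_pow
  have hlpos : 1 ≤ 2 ^ l := Nat.one_le_two_pow
  -- 2^l = 2^k + 2
  have hkl : 2 ^ l = 2 ^ k + 2 := by omega
  rcases Nat.lt_or_ge k 2 with hk2 | hk2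
  · interval_cases k
    · -- u = 2: (1)(3) = 3 is not a power of two
      exfalso
      have hu2 : u = 2 := by omega
      subst hu2
      norm_num at h
      exact two_pow_ne_three i h.symm
    · omega
  · -- k ≥ 2: then 4 ∣ 2^l = 2^k + 2, so 4 ∣ 2, absurd (l ≥ 2); and l ≤ 1 is too small
    exfalso
    have h4k := four_dvd_two_pow hk2
    rcases Nat.lt_or_ge l 2 with hl2 | hl2
    · interval_cases l <;> omega
    · have h4l := four_dvd_two_pow hl2
      omega

/-- From `2^i + 1 = q^(2m)` with `q^m ≥ 2`: `(q^m − 1)(q^m + 1) = 2^i`. [folklore] -/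
theorem pred_mul_succ_of_sq {q m i : ℕ} (h : 2 ^ i + 1 = q ^ (2 * m)) :
    (q ^ m - 1) * (q ^ m + 1) = 2 ^ i := by
  have hsq : q ^ (2 * m) = q ^ m * q ^ m := by rw [pow_mul', sq]
  rw [hsq] at h
  have hpos : 0 < q ^ m := by
    rcases Nat.eq_zero_or_pos (q ^ m) with h0 | h0
    · exfalso; rw [h0] at h; simp at h
    · exact h0
  obtain ⟨v, hv⟩ : ∃ v, q ^ m = v + 1 := ⟨q ^ m - 1, by omega⟩
  rw [hv] at h ⊢
  have key : (v + 1) * (v + 1) = (v + 1 - 1) * (v + 1 + 1) + 1 := by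
    simp only [Nat.add_sub_cancel]; ring
  omega

/-! ## `q = 3` -/

/-- **Levi ben Gerson (1343)**: `2^i + 1 = 3^j` only for `(i, j) = (1, 1), (3, 2)`. [folklore] -/
theorem two_pow_add_one_eq_three_pow {i j : ℕ} (h : 2 ^ i + 1 = 3 ^ j) :
    (i = 1 ∧ j = 1) ∨ (i = 3 ∧ j = 2) := by
  rcases Nat.lt_or_ge i 3 with hi | hi
  · interval_cases i
    · -- 2 = 3^j
      exfalso
      have h3 : 3 ^ j % 2 = 1 := by rw [Nat.pow_mod]; norm_num
      omega
    · -- 3 = 3^j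
      left
      have h1 : 3 ^ j = 3 ^ 1 := by rw [pow_one]; omega
      exact ⟨rfl, pow_exp_eq (by norm_num) h1⟩
    · -- 5 = 3^j
      exfalso
      rcases Nat.lt_or_ge j 2 with hj | hj
      · interval_cases j <;> omega
      · have h9 : 3 ^ 2 ∣ 3 ^ j := pow_dvd_pow 3 hj
        rw [show (3 : ℕ) ^ j = 5 by omega] at h9
        norm_num at h9
  · -- i ≥ 3: 3^j ≡ 1 (mod 8), so j = 2m, and (3^m - 1)(3^m + 1) = 2^i
    right
    have h8 := eight_dvd_two_pow hi
    have hj8 : 3 ^ j % 8 = 1 := by omega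
    obtain ⟨m, hm⟩ := even_of_three_pow_mod_eight hj8
    have hj2 : j = 2 * m := by omega
    subst hj2
    have hfac := pred_mul_succ_of_sq h
    have hm1 : 1 ≤ m := by
      rcases Nat.eq_zero_or_pos m with h0 | h0
      · subst h0; simp at h
      · exact h0
    have hu2 : 2 ≤ 3 ^ m := by
      have : 3 ^ 1 ≤ 3 ^ m := Nat.pow_le_pow_right (by norm_num) hm1
      omega
    have hu3 : 3 ^ m = 3 := eq_three_of_pred_mul_succ_eq_two_pow hu2 hfac
    have hm1' : m = 1 := pow_exp_eq (by norm_num) (hu3.trans (pow_one 3).symm)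
    subst hm1'
    have hi3 : 2 ^ i = 2 ^ 3 := by norm_num at h; omega
    exact ⟨pow_exp_eq (by norm_num) hi3, rfl⟩

/-- `3^j + 1 = 2^i` only for `(j, i) = (0, 1), (1, 2)`. [folklore] -/
theorem three_pow_add_one_eq_two_pow {i j : ℕ} (h : 3 ^ j + 1 = 2 ^ i) :
    (j = 0 ∧ i = 1) ∨ (j = 1 ∧ i = 2) := by
  rcases Nat.lt_or_ge i 3 with hi | hi
  · interval_cases i
    · exfalso
      have : 1 ≤ 3 ^ j := Nat.one_le_pow _ _ (by norm_num)
      norm_num at h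
    · left
      have h1 : 3 ^ j = 3 ^ 0 := by rw [pow_zero]; omega
      exact ⟨pow_exp_eq (by norm_num) h1, rfl⟩
    · right
      have h1 : 3 ^ j = 3 ^ 1 := by rw [pow_one]; omega
      exact ⟨pow_exp_eq (by norm_num) h1, rfl⟩
  · exfalso
    have h8 := eight_dvd_two_pow hi
    rcases three_pow_mod_eight j with h3 | h3 <;> omega

/-! ## `q = 5` -/

/-- `2^i + 1 = 5^j` only for `(i, j) = (2, 1)`. [folklore] -/
theorem two_pow_add_one_eq_five_pow {i j : ℕ} (h : 2 ^ i + 1 = 5 ^ j) : i = 2 ∧ j = 1 := by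
  rcases Nat.lt_or_ge i 3 with hi | hi
  · interval_cases i
    · exfalso
      have h5 : 5 ^ j % 2 = 1 := by rw [Nat.pow_mod]; norm_num
      omega
    · exfalso
      -- 5^j = 3
      rcases Nat.lt_or_ge j 1 with hj | hj
      · interval_cases j; omega
      · have h5 : 5 ^ 1 ∣ 5 ^ j := pow_dvd_pow 5 hj
        rw [show (5 : ℕ) ^ j = 3 by omega] at h5
        norm_num at h5
    · have h1 : 5 ^ j = 5 ^ 1 := by rw [pow_one]; omega
      exact ⟨rfl, pow_exp_eq (by norm_num) h1⟩
  · -- i ≥ 3: 5^j ≡ 1 (mod 8), j = 2m, (5^m - 1)(5^m + 1) = 2^i forces 5^m = 3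
    exfalso
    have h8 := eight_dvd_two_pow hi
    have hj8 : 5 ^ j % 8 = 1 := by omega
    obtain ⟨m, hm⟩ := even_of_five_pow_mod_eight hj8
    have hj2 : j = 2 * m := by omega
    subst hj2
    have hfac := pred_mul_succ_of_sq h
    have hm1 : 1 ≤ m := by
      rcases Nat.eq_zero_or_pos m with h0 | h0
      · subst h0; simp at h
      · exact h0
    have hu2 : 2 ≤ 5 ^ m := by
      have : 5 ^ 1 ≤ 5 ^ m := Nat.pow_le_pow_right (by norm_num) hm1
      omega
    have hu3 : 5 ^ m = 3 := eq_three_of_pred_mul_succ_eq_two_pow hu2 hfac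
    have h5 : 5 ^ 1 ∣ 5 ^ m := pow_dvd_pow 5 hm1
    rw [hu3] at h5
    norm_num at h5

/-- `5^j + 1 = 2^i` only for `(j, i) = (0, 1)`. [folklore] -/
theorem five_pow_add_one_eq_two_pow {i j : ℕ} (h : 5 ^ j + 1 = 2 ^ i) : j = 0 ∧ i = 1 := by
  have h4 : 5 ^ j % 4 = 1 := by rw [Nat.pow_mod]; norm_num
  rcases Nat.lt_or_ge i 2 with hi | hi
  · interval_cases i
    · exfalso
      have : 1 ≤ 5 ^ j := Nat.one_le_pow _ _ (by norm_num)
      norm_num at h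
    · have h1 : 5 ^ j = 5 ^ 0 := by rw [pow_zero]; omega
      exact ⟨pow_exp_eq (by norm_num) h1, rfl⟩
  · exfalso
    have h4i := four_dvd_two_pow hi
    omega

/-! ## `q = 7` -/

/-- `2^i + 1 ≠ 7^j` (reduce mod `3`). [folklore] -/
theorem two_pow_add_one_ne_seven_pow (i j : ℕ) : 2 ^ i + 1 ≠ 7 ^ j := by
  intro h
  have h7 : 7 ^ j % 3 = 1 := by rw [Nat.pow_mod]; norm_num
  rcases two_pow_mod_three i with h2 | h2 <;> omega

/-- `7^j + 1 = 2^i` only for `(j, i) = (0, 1), (1, 3)` (reduce mod `16`). [folklore] -/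
theorem seven_pow_add_one_eq_two_pow {i j : ℕ} (h : 7 ^ j + 1 = 2 ^ i) :
    (j = 0 ∧ i = 1) ∨ (j = 1 ∧ i = 3) := by
  rcases Nat.lt_or_ge i 4 with hi | hi
  · interval_cases i
    · exfalso
      have : 1 ≤ 7 ^ j := Nat.one_le_pow _ _ (by norm_num)
      norm_num at h
    · left
      have h1 : 7 ^ j = 7 ^ 0 := by rw [pow_zero]; omega
      exact ⟨pow_exp_eq (by norm_num) h1, rfl⟩
    · exfalso
      -- 7^j = 3
      rcases Nat.lt_or_ge j 1 with hj | hj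
      · interval_cases j; norm_num at h
      · have h7 : 7 ^ 1 ∣ 7 ^ j := pow_dvd_pow 7 hj
        rw [show (7 : ℕ) ^ j = 3 by omega] at h7
        norm_num at h7
    · right
      have h1 : 7 ^ j = 7 ^ 1 := by rw [pow_one]; omega
      exact ⟨pow_exp_eq (by norm_num) h1, rfl⟩
  · exfalso
    have h16 := sixteen_dvd_two_pow hi
    rcases seven_pow_mod_sixteen j with h7 | h7 <;> omega

/-! ## `q = 11` -/

/-- `2^i + 1 ≠ 11^j` (reduce mod `5`). [folklore] -/
theorem two_pow_add_one_ne_eleven_pow (i j : ℕ) : 2 ^ i + 1 ≠ 11 ^ j := by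
  intro h
  have h11 : 11 ^ j % 5 = 1 := by rw [Nat.pow_mod]; norm_num
  have := two_pow_mod_five_ne_zero i
  omega

/-- `11^j + 1 = 2^i` only for `(j, i) = (0, 1)` (reduce mod `8`). [folklore] -/
theorem eleven_pow_add_one_eq_two_pow {i j : ℕ} (h : 11 ^ j + 1 = 2 ^ i) : j = 0 ∧ i = 1 := by
  rcases Nat.lt_or_ge i 3 with hi | hi
  · interval_cases i
    · exfalso
      have : 1 ≤ 11 ^ j := Nat.one_le_pow _ _ (by norm_num)
      norm_num at h
    · have h1 : 11 ^ j = 11 ^ 0 := by rw [pow_zero]; omega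
      exact ⟨pow_exp_eq (by norm_num) h1, rfl⟩
    · exfalso
      -- 11^j = 3
      rcases Nat.lt_or_ge j 1 with hj | hj
      · interval_cases j; norm_num at h
      · have h11 : 11 ^ 1 ∣ 11 ^ j := pow_dvd_pow 11 hj
        rw [show (11 : ℕ) ^ j = 3 by omega] at h11
        norm_num at h11
  · exfalso
    have h8 := eight_dvd_two_pow hi
    rcases eleven_pow_mod_eight j with h11 | h11 <;> omega

/-! ## `q = 13` -/

/-- `2^i + 1 ≠ 13^j` (reduce mod `3`). [folklore] -/
theorem two_pow_add_one_ne_thirteen_pow (i j : ℕ) : 2 ^ i + 1 ≠ 13 ^ j := by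
  intro h
  have h13 : 13 ^ j % 3 = 1 := by rw [Nat.pow_mod]; norm_num
  rcases two_pow_mod_three i with h2 | h2 <;> omega

/-- `13^j + 1 = 2^i` only for `(j, i) = (0, 1)` (reduce mod `4`). [folklore] -/
theorem thirteen_pow_add_one_eq_two_pow {i j : ℕ} (h : 13 ^ j + 1 = 2 ^ i) : j = 0 ∧ i = 1 := by
  have h4 : 13 ^ j % 4 = 1 := by rw [Nat.pow_mod]; norm_num
  rcases Nat.lt_or_ge i 2 with hi | hi
  · interval_cases i
    · exfalso
      have : 1 ≤ 13 ^ j := Nat.one_le_pow _ _ (by norm_num)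
      norm_num at h
    · have h1 : 13 ^ j = 13 ^ 0 := by rw [pow_zero]; omega
      exact ⟨pow_exp_eq (by norm_num) h1, rfl⟩
  · exfalso
    have h4i := four_dvd_two_pow hi
    omega

/-! ## Summary: the largest member is at most `9` -/

/-- For an odd prime `q ≤ 13`, every solution of `2^i + 1 = q^j` has `q^j ≤ 9`. [folklore] -/
theorem pow_le_nine_of_two_pow_add_one_eq {q i j : ℕ} (hq : q.Prime) (hq2 : q ≠ 2) (hq13 : q ≤ 13)
    (h : 2 ^ i + 1 = q ^ j) : q ^ j ≤ 9 := by
  have hq3 : 3 ≤ q := by have := hq.two_le; omega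
  interval_cases q
  · rcases two_pow_add_one_eq_three_pow h with ⟨-, rfl⟩ | ⟨-, rfl⟩ <;> norm_num
  · norm_num at hq
  · obtain ⟨-, rfl⟩ := two_pow_add_one_eq_five_pow h; norm_num
  · norm_num at hq
  · exact absurd h (two_pow_add_one_ne_seven_pow i j)
  · norm_num at hq
  · norm_num at hq
  · norm_num at hq
  · exact absurd h (two_pow_add_one_ne_eleven_pow i j)
  · norm_num at hq
  · exact absurd h (two_pow_add_one_ne_thirteen_pow i j)

/-- For an odd prime `q ≤ 13`, every solution of `q^j + 1 = 2^i` has `2^i ≤ 8`. [folklore] -/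
theorem pow_le_eight_of_pow_add_one_eq_two_pow {q i j : ℕ} (hq : q.Prime) (hq2 : q ≠ 2)
    (hq13 : q ≤ 13) (h : q ^ j + 1 = 2 ^ i) : 2 ^ i ≤ 8 := by
  have hq3 : 3 ≤ q := by have := hq.two_le; omega
  interval_cases q
  · rcases three_pow_add_one_eq_two_pow h with ⟨-, rfl⟩ | ⟨-, rfl⟩ <;> norm_num
  · norm_num at hq
  · obtain ⟨-, rfl⟩ := five_pow_add_one_eq_two_pow h; norm_num
  · norm_num at hq
  · rcases seven_pow_add_one_eq_two_pow h with ⟨-, rfl⟩ | ⟨-, rfl⟩ <;> norm_num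
  · norm_num at hq
  · norm_num at hq
  · norm_num at hq
  · obtain ⟨-, rfl⟩ := eleven_pow_add_one_eq_two_pow h; norm_num
  · norm_num at hq
  · obtain ⟨-, rfl⟩ := thirteen_pow_add_one_eq_two_pow h; norm_num

end Summit.ABC.ABC.Theorems.SparseGoodScales.Negative
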